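import Summits.Ventures.PercRepro.C041TriSharp
import Summits.Ventures.PercRepro.C041BlockMapCores5C
import Summits.Ventures.PercRepro.C041BlockMapCores5D
import Summits.Ventures.PercRepro.C041BlockMapCores5E

/-!
# ROW C-041 — THE EXACT DICHOTOMY, FILE B: the non-dominated cores `theta_c5_6`, `theta_c5_8`, `theta_c5_9`, `theta_c5_10`, `theta_c5_11`, `theta_c5_12`, `theta_c5_13` as whole triangles + bare apart excesses +
tree maps (p6, gen 39; P6-TWOEXIT-LEAN.md §51; GENERATED by lean-drafts/p6/g39/genexc.py from the exact LP of domin5.py)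

The 20 two-exit cores on `≤ 5` vertices that are NOT triangle-dominated (`C041TriDomK4`, `C041TriDomCores5A–D` hold the 18
that are) are nevertheless exact non-negative integer combinations of whole triangles `θ_△`, BARE APART EXCESSES
`apartExcess w w′ = θ_B w θ_B w′ + θ_R w θ_R w′` (`C041TriSharp`) and tree maps (`theta_eq_excess`, identities of bilinear forms
checked by `ring`): this is the precise sense in which they lie «beyond the triangle» — every one needs at least one bare
apart excess, and the apart excess is not a (P)-map (`not_K4v_apartExcess`), so no domination argument reduces their cone
forms to the triangle's.  The diamonds' (P) for relaxed inputs is THEOREM (RELAXED D1 / D2) (gen 38, certificates); their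
CONE forms and those of the 18 five-vertex cores here are the open cases beyond the triangle (§38, §49).
-/

namespace PercRepro

namespace ZoneZ

namespace MultiExit

open TreeClosure RelaxedTriangle

/-- **THE EXCESS IDENTITY OF `theta_c5_6`**: `6` whole triangles, `2` bare apart excesses, and tree maps. -/
theorem theta_c5_6_eq_excess (w w' : Vec6) :
    theta_c5_6 w w' = (6 : ℝ) • (thetaTri w w') + (2 : ℝ) • (apartExcess w w') + (4 : ℝ) • (ellv (w * w')) + (14 : ℝ) • (w * ellv w') + (7 : ℝ) • (ellv (w * ellv w')) + (12 : ℝ) • (w * w') := by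
  ext i
  simp only [theta_c5_6, apartExcess, thetaTri_eq_sum, Pi.add_apply, Pi.mul_apply, Pi.smul_apply, smul_eq_mul, thB,
    thR, ellv, ell, nAdm, kInv]
  fin_cases i <;> simp <;> ring

/-- **THE EXCESS IDENTITY OF `theta_c5_8`**: `6` whole triangles, `2` bare apart excesses, and tree maps. -/
theorem theta_c5_8_eq_excess (w w' : Vec6) :
    theta_c5_8 w w' = (6 : ℝ) • (thetaTri w w') + (1 : ℝ) • (thetaTri w (ellv w')) + (2 : ℝ) • (apartExcess w w') + (14 : ℝ) • (w * ellv w') + (2 : ℝ) • (ellv w * ellv w') + (2 : ℝ) • (ellv (w * ellv w')) + (4 : ℝ) • (w * (nAdm w' • (1 : Vec6))) + (12 : ℝ) • (w * w') := by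
  ext i
  simp only [theta_c5_8, apartExcess, thetaTri_eq_sum, Pi.add_apply, Pi.mul_apply, Pi.smul_apply, Pi.one_apply, smul_eq_mul, thB,
    thR, ellv, ell, nAdm, kInv]
  fin_cases i <;> simp <;> ring

/-- **THE EXCESS IDENTITY OF `theta_c5_9`**: `4` whole triangles, `2` bare apart excesses, and tree maps. -/
theorem theta_c5_9_eq_excess (w w' : Vec6) :
    theta_c5_9 w w' = (4 : ℝ) • (thetaTri w w') + (2 : ℝ) • (thetaTri w (ellv w')) + (2 : ℝ) • (apartExcess w w') + (5 : ℝ) • (ellv w * w') + (10 : ℝ) • (w * ellv w') + (6 : ℝ) • (ellv w * ellv w') + (6 : ℝ) • (w * w') := by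
  ext i
  simp only [theta_c5_9, apartExcess, thetaTri_eq_sum, Pi.add_apply, Pi.mul_apply, Pi.smul_apply, smul_eq_mul, thB,
    thR, ellv, ell, nAdm, kInv]
  fin_cases i <;> simp <;> ring

/-- **THE EXCESS IDENTITY OF `theta_c5_10`**: `1` whole triangles, `2` bare apart excesses, and tree maps. -/
theorem theta_c5_10_eq_excess (w w' : Vec6) :
    theta_c5_10 w w' = (1 : ℝ) • (thetaTri w w') + (2 : ℝ) • (apartExcess w w') + (14 : ℝ) • (ellv (w * w')) + (14 : ℝ) • (w * ellv w') + (12 : ℝ) • (ellv (w * ellv w')) + (12 : ℝ) • (w * w') := by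
  ext i
  simp only [theta_c5_10, apartExcess, thetaTri_eq_sum, Pi.add_apply, Pi.mul_apply, Pi.smul_apply, smul_eq_mul, thB,
    thR, ellv, ell, nAdm, kInv]
  fin_cases i <;> simp <;> ring

/-- **THE EXCESS IDENTITY OF `theta_c5_11`**: `6` whole triangles, `2` bare apart excesses, and tree maps. -/
theorem theta_c5_11_eq_excess (w w' : Vec6) :
    theta_c5_11 w w' = (6 : ℝ) • (thetaTri w w') + (2 : ℝ) • (apartExcess w w') + (14 : ℝ) • (ellv (w * w')) + (4 : ℝ) • (w * ellv w') + (7 : ℝ) • (ellv (w * ellv w')) + (12 : ℝ) • (w * w') := by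
  ext i
  simp only [theta_c5_11, apartExcess, thetaTri_eq_sum, Pi.add_apply, Pi.mul_apply, Pi.smul_apply, smul_eq_mul, thB,
    thR, ellv, ell, nAdm, kInv]
  fin_cases i <;> simp <;> ring

/-- **THE EXCESS IDENTITY OF `theta_c5_12`**: `4` whole triangles, `2` bare apart excesses, and tree maps. -/
theorem theta_c5_12_eq_excess (w w' : Vec6) :
    theta_c5_12 w w' = (4 : ℝ) • (thetaTri w w') + (2 : ℝ) • (thetaTri w (ellv w')) + (2 : ℝ) • (apartExcess w w') + (5 : ℝ) • (ellv (w * w')) + (10 : ℝ) • (w * ellv w') + (6 : ℝ) • (ellv (w * ellv w')) + (6 : ℝ) • (w * w') := by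
  ext i
  simp only [theta_c5_12, apartExcess, thetaTri_eq_sum, Pi.add_apply, Pi.mul_apply, Pi.smul_apply, smul_eq_mul, thB,
    thR, ellv, ell, nAdm, kInv]
  fin_cases i <;> simp <;> ring

/-- **THE EXCESS IDENTITY OF `theta_c5_13`**: `6` whole triangles, `3` bare apart excesses, and tree maps. -/
theorem theta_c5_13_eq_excess (w w' : Vec6) :
    theta_c5_13 w w' = (6 : ℝ) • (thetaTri w w') + (3 : ℝ) • (apartExcess w w') + (15 : ℝ) • (ellv (w * w')) + (3 : ℝ) • (ellv (ellv w * w')) + (3 : ℝ) • (ellv (w * ellv w')) + (6 : ℝ) • (nAdm (w * w') • (1 : Vec6)) + (1 : ℝ) • (nAdm (w * ellv w') • (1 : Vec6)) + (12 : ℝ) • (w * w') := by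
  ext i
  simp only [theta_c5_13, apartExcess, thetaTri_eq_sum, Pi.add_apply, Pi.mul_apply, Pi.smul_apply, Pi.one_apply, smul_eq_mul, thB,
    thR, ellv, ell, nAdm, kInv]
  fin_cases i <;> simp <;> ring

end MultiExit

end ZoneZ

end PercRepro
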